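import Mathlib
import HarnessLib
import Literature.Analysis.FluidPDE.Tao2016AveragedNS.LocalCascadeSolutions
import Literature.Analysis.FluidPDE.Tao2016AveragedNS.RenormalisedCascadeWaves
import Literature.Analysis.FluidPDE.Tao2016AveragedNS.ViscousEternalSolutions
import Literature.Analysis.FluidPDE.Tao2016AveragedNS.BoundedEternalSolutions
import Summits.NavierStokesRegularity.NavierStokesRegularity.Theorems.TaoLadderRungTwoBreakNoSurvivingEternalViscBddOneSmallActionRung
import Summits.NavierStokesRegularity.NavierStokesRegularity.Theorems.TaoLadderRungTwoBreakNoSurvivingEternalViscBddOneTailConveyor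
import Summits.NavierStokesRegularity.NavierStokesRegularity.Theorems.TaoLadderRungTwoBreakNoSurvivingEternalViscBddOneTailSlaving
import Summits.NavierStokesRegularity.NavierStokesRegularity.Theorems.TaoLadderRungTwoBreakNoSurvivingEternalViscBddOneTailBarrier
import Summits.NavierStokesRegularity.NavierStokesRegularity.Theorems.TaoLadderRungTwoBreakNoSurvivingEternalViscBddOneTailBarrierOrthant
import Summits.NavierStokesRegularity.NavierStokesRegularity.Theorems.TaoLadderRungTwoBreakNoSurvivingEternalViscBddOneSurvivalLoudGeneral

/-!
# Crux K1ᵛ(1) `TaoLadderRungTwoBreak.NoSurvivingEternalViscBddOne` (stmt-NavierStokesRegularity-20419):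
# EVERY TAIL OF A BOUNDED ADMISSIBLE ETERNAL SOLUTION IS QUIET IN SOME PAST — on EVERY cancelling table,
# for EVERY covariant viscosity `ν̂ ≥ 0` (the activity never descends from `k = +∞`); hence ordered ignition,
# the loud down-set and «(S₁)-survival lights every shell» hold UNCONDITIONALLY

MODEL lattice ODEs only (Tao 2016 §4 in the self-similar log-time variables of §6.4; cell vocabulary
`IsEternalVisc`, `UniformBound`, `physEnergy`, `physFlux`, `EternalSurvivingFwd`); nothing in this file is a
statement about the Navier–Stokes equations, and no summit, crux or rung LEAF is proved by it
(`--supports stmt-NavierStokesRegularity-20419`).  `C_A = fluxConst α`, `Λ = bigLam ε₀`, `q₀ = 1/(4Λ(C_A+1))`.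

The tail barrier of this route (`…TailBarrier`, `…SurvivalLoudGeneral`) needs ONE hypothesis at `ν̂ = 0` on a
general (backscattering) table: a QUIET PAST of the tail, `∀ n ∃ σ₀ ∀ j ≥ n ∀ s ≤ σ₀, ‖W_j(s)‖ ≤ q₀` — known for
`ν̂ > 0` (`exists_quietPast_of_visc`), on sign-coherent bonds (`exists_quietPast_of_flux_nonneg`) and on the DSS
stratum (`dss_exists_quietPast`); census CENSUS-20419-leafhand-5-g0 (T2) asked whether activity descending from
`k = +∞` is possible for a bounded admissible INVISCID eternal solution of a general table.  It is not:

* `normSq_succ_le_of_quiet_below` — ENERGY FROM ABOVE IS FED ONLY THROUGH THE SHELL BELOW: if shell `k-1`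
  obeys `‖W_{k-1}‖ ≤ q` on `(-∞, σ₀]` and `‖W‖ ≤ B`, then `‖W_{k+1}(s)‖² ≤ Λ³ C_A B q²` for `s ≤ σ₀` (the
  finite block `E_k + ⋯ + E_{k+M-1}` vanishes at `σ = -∞` and gains only through the bond `(k-1) → k`, flux
  `≤ 2C_AΛ⁻¹ B E_{k-1}`, and the top bond, flux `O(Λ^{-2(k+M)}e^{2σ})`, `M → ∞`; interior fluxes telescope
  by (4.3), dissipation has a sign; tree `hasDerivAt_tail`, `abs_physFlux_le`).
* `quiet_propagate` — QUIETNESS CLIMBS THE LADDER: at a level `q` with `2ΛC_A q ≤ 1`, `16ΛC_A³Bq² ≤ 1`, if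
  shell `n` is `q`-quiet on `(-∞, σ₀]` then so is every shell `n + i` (the energy bound puts shell `n+i+2`
  inside the backscatter margin `4C_A‖W‖ ≤ Λ`; `norm_le_slaved` bounds shell `n+i+1` by `2ΛC_A q² ≤ q`).
* `exists_quietPast` — **every tail of a uniformly bounded admissible eternal solution of a cancelling
  table is quiet at ANY level `q > 0` in some past**, for every `ν̂ ≥ 0` (inviscid: shell `n` alone tends to
  `0` at `-∞`, `tendsto_norm_atBot_of_isEternal`, then `quiet_propagate`; viscous: `exists_quietPast_of_visc`).
* Consequences, UNCONDITIONAL for every `ν̂ ≥ 0` and every cancelling table: `orderedIgnition_all`,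
  `loud_downset_all`, `survivingFwd_loud_everywhere` ((S₁)-survival lights EVERY shell `j ∈ ℤ`), and BY NAME on
  the crux's binders `loud_everywhere_of_crux_binders`.

READING for ⟨20419⟩ / (ρ0): the front of EVERY bounded admissible eternal solution comes up the ladder from
`n = -∞`, backscatter notwithstanding; «frequently loud» = «loud on every shell».  The WAKE estimate, which
decides (ρ0)/(ρ+), is untouched.  HONEST LABEL: structure theorem for the objects the Liouville crux quantifies
over; `stub_noSurvivingEternalBddOne`, `stub_noLoudLadderOne`, ⟨20419⟩ and every NS statement stay OPEN; rung 0.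
-/

noncomputable section

-- the summit and its single sub-problem share the name (CONVENTIONS §1)
set_option linter.dupNamespace false

namespace Summit.NavierStokesRegularity.NavierStokesRegularity.Theorems.NoSurvivingEternalViscBddOne.TailBarrier

open Set Filter Topology MeasureTheory
open scoped RealInnerProductSpace
open Literature.Analysis.FluidPDE Literature.Analysis.FluidPDE.TaoCascade
open Summit.NavierStokesRegularity.NavierStokesRegularity.Theorems.NoSurvivingEternalViscBddOne.SmallAction
  (continuous_physEnergy continuous_physFlux physEnergy_le_exp tendsto_physEnergy_atBot viscCoef_nonneg)
open Summit.NavierStokesRegularity.NavierStokesRegularity.Theorems.NoSurvivingEternalViscBddOne.TailConveyor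
  (zpow_inv_sq_split)

variable {m : ℕ} {ε₀ νh : ℝ} {α : Fin m → Fin m → Fin m → ℤ × ℤ × ℤ → ℝ} {W : ℤ → ℝ → Em m}

/-! ## Energy from above is fed only through the shell below -/

/-- `d/dx e^{2x} = 2 e^{2x}`. [folklore] -/
private theorem hasDerivAt_exp_two_mul' (x : ℝ) :
    HasDerivAt (fun y : ℝ => Real.exp (2 * y)) (2 * Real.exp (2 * x)) x := by
  have h : HasDerivAt (fun y : ℝ => 2 * y) 2 x := by
    simpa using (hasDerivAt_id x).const_mul (2 : ℝ)
  convert h.exp using 1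
  ring

/-- `e^{2s} ‖W_n(s)‖² = (Λ^n)² E_n(s)` (the physical energy read back in renormalised amplitude).
[cite: Tao2016AveragedNS, §4 Lemma 4.1 (4.10) in the self-similar variables of §6.4; cell vocabulary `physEnergy`] -/
theorem exp_mul_normSq_eq_physEnergy (hε : 0 < ε₀) (W : ℤ → ℝ → Em m) (n : ℤ) (s : ℝ) :
    Real.exp (2 * s) * ‖W n s‖ ^ 2 = (bigLam ε₀ ^ n) ^ 2 * physEnergy ε₀ W n s := by
  have hΛ : bigLam ε₀ ^ n ≠ 0 := (zpow_pos (bigLam_pos (by linarith)) n).ne'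
  unfold physEnergy
  field_simp

/-- **ENERGY FROM ABOVE IS FED ONLY THROUGH THE SHELL BELOW.**  Let `W` be an admissible eternal solution with
covariant viscosity `ν̂ ≥ 0` of a cancelling table, `‖W_j(σ)‖ ≤ B` for all `j, σ`.  If the shell `k - 1` obeys
`‖W_{k-1}(s)‖ ≤ q` for all `s ≤ σ₀`, then `‖W_{k+1}(s)‖² ≤ Λ³ C_A B q²` for all `s ≤ σ₀` (finite block
`E_k + ⋯ + E_{k+M-1}`: vanishes at `-∞`, interior fluxes telescope, dissipation signed, bottom flux
`≤ 2C_AΛ⁻¹ B E_{k-1}`, top flux geometrically small in `M`; and `E_{k+1} ≤` block).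
[cite: Tao2016AveragedNS, §4 (4.3), Lemma 4.1 (4.8)–(4.10), the viscous equation before Thm. 4.2, §6.4; tree `hasDerivAt_tail`, `abs_physFlux_le`] -/
theorem normSq_succ_le_of_quiet_below (hε : 0 < ε₀) (hW : IsEternalVisc ε₀ νh α W)
    (hc : IsCancellingCoeff α) {B : ℝ} (hB : ∀ (j : ℤ) (σ : ℝ), ‖W j σ‖ ≤ B)
    {k : ℤ} {σ₀ q : ℝ} (hquiet : ∀ s, s ≤ σ₀ → ‖W (k - 1) s‖ ≤ q) :
    ∀ s, s ≤ σ₀ → ‖W (k + 1) s‖ ^ 2 ≤ bigLam ε₀ ^ 3 * fluxConst α * B * q ^ 2 := by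
  intro s hs
  have hΛ : 0 < bigLam ε₀ := bigLam_pos (by linarith)
  have hΛ1 : 1 < bigLam ε₀ := by unfold bigLam; exact Real.one_lt_rpow (by linarith) (by norm_num)
  have hCA : 0 ≤ fluxConst α := fluxConst_nonneg α
  have hB0 : 0 ≤ B := (norm_nonneg _).trans (hB 0 0)
  have hq0 : 0 ≤ q := (norm_nonneg _).trans (hquiet s hs)
  set P : ℝ := (bigLam ε₀ ^ (k - 1))⁻¹ ^ 2 with hP
  have hP0 : 0 < P := by positivity
  set r : ℝ := (bigLam ε₀)⁻¹ ^ 2 with hr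
  have hr0 : 0 ≤ r := by positivity
  have hr1 : r < 1 := by
    have : (bigLam ε₀)⁻¹ < 1 := inv_lt_one_of_one_lt₀ hΛ1
    have h0 : 0 ≤ (bigLam ε₀)⁻¹ := inv_nonneg.2 hΛ.le
    rw [hr]; nlinarith
  -- (Λ^{k+1})² · P = Λ⁴
  have hk1 : bigLam ε₀ ^ (k + 1) = bigLam ε₀ ^ (k - 1) * bigLam ε₀ ^ 2 := by
    rw [← zpow_natCast, ← zpow_add₀ hΛ.ne']; congr 1; push_cast; ring
  have hweight : (bigLam ε₀ ^ (k + 1)) ^ 2 * P = bigLam ε₀ ^ 4 := by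
    have hz : bigLam ε₀ ^ (k - 1) ≠ 0 := (zpow_pos hΛ _).ne'
    rw [hk1, hP]
    field_simp
  -- MAIN CLAIM for every block length M ≥ 2
  have hmain : ∀ M : ℕ, 2 ≤ M →
      ‖W (k + 1) s‖ ^ 2 ≤ bigLam ε₀ ^ 3 * fluxConst α * B * q ^ 2
        + bigLam ε₀ ^ 3 * fluxConst α * B ^ 3 * r ^ M := by
    intro M hM
    -- the block `E_k + ⋯ + E_{k+M-1}` and its derivative
    set T : ℝ → ℝ := fun x => ∑ j ∈ Finset.range M, physEnergy ε₀ W (k - 1 + 1 + j) x with hT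
    set D : ℝ → ℝ := fun x => physFlux ε₀ α W (k - 1) x - physFlux ε₀ α W (k - 1 + M) x
        - ∑ j ∈ Finset.range M, 2 * viscCoef ε₀ νh (k - 1 + 1 + j) x * physEnergy ε₀ W (k - 1 + 1 + j) x
      with hD
    have hderiv : ∀ x, HasDerivAt T (D x) x := fun x => hasDerivAt_tail hε hW hc (k - 1) M x
    set c : ℝ := fluxConst α * (bigLam ε₀)⁻¹ * B * P * (q ^ 2 + B ^ 2 * r ^ M) with hcdef
    have hc0 : 0 ≤ c := by positivity
    -- D ≤ 2 c e^{2x} on (-∞, σ₀]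
    have hDle : ∀ x, x ≤ σ₀ → D x ≤ 2 * c * Real.exp (2 * x) := by
      intro x hx
      have hF1 := (le_abs_self _).trans (abs_physFlux_le hε hc W (k - 1) x)
      have hF2 := (neg_le_abs _).trans (abs_physFlux_le hε hc W (k - 1 + M) x)
      have hvis : 0 ≤ ∑ j ∈ Finset.range M,
          2 * viscCoef ε₀ νh (k - 1 + 1 + j) x * physEnergy ε₀ W (k - 1 + 1 + j) x :=
        Finset.sum_nonneg fun j _ =>
          mul_nonneg (mul_nonneg two_pos.le (viscCoef_nonneg hε hW.nonneg _ _)) (physEnergy_nonneg ε₀ W _ x)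
      -- bottom bond: E_{k-1}(x) ≤ P q² e^{2x}
      have hE1 : physEnergy ε₀ W (k - 1) x ≤ P * (Real.exp (2 * x) * q ^ 2) := by
        have h1 : ‖W (k - 1) x‖ ^ 2 ≤ q ^ 2 := pow_le_pow_left₀ (norm_nonneg _) (hquiet x hx) 2
        unfold physEnergy
        exact mul_le_mul_of_nonneg_left (mul_le_mul_of_nonneg_left h1 (Real.exp_pos _).le) hP0.le
      have hb1 : 2 * fluxConst α * (bigLam ε₀)⁻¹ * ‖W (k - 1 + 1) x‖ * physEnergy ε₀ W (k - 1) x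
          ≤ 2 * fluxConst α * (bigLam ε₀)⁻¹ * B * (P * (Real.exp (2 * x) * q ^ 2)) := by
        have h2 : 2 * fluxConst α * (bigLam ε₀)⁻¹ * ‖W (k - 1 + 1) x‖ ≤ 2 * fluxConst α * (bigLam ε₀)⁻¹ * B :=
          mul_le_mul_of_nonneg_left (hB _ x) (by positivity)
        exact mul_le_mul h2 hE1 (physEnergy_nonneg ε₀ W _ x) (by positivity)
      -- top bond: E_{k-1+M}(x) ≤ P r^M B² e^{2x}
      have hE2 : physEnergy ε₀ W (k - 1 + M) x ≤ P * r ^ M * B ^ 2 * Real.exp (2 * x) := by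
        have h1 := physEnergy_le_exp hε hB (k - 1 + M) x
        rw [zpow_inv_sq_split hΛ.ne' (k - 1) M] at h1
        simpa only [hP, hr] using h1
      have hb2 : 2 * fluxConst α * (bigLam ε₀)⁻¹ * ‖W (k - 1 + M + 1) x‖ * physEnergy ε₀ W (k - 1 + M) x
          ≤ 2 * fluxConst α * (bigLam ε₀)⁻¹ * B * (P * r ^ M * B ^ 2 * Real.exp (2 * x)) := by
        have h2 : 2 * fluxConst α * (bigLam ε₀)⁻¹ * ‖W (k - 1 + M + 1) x‖
            ≤ 2 * fluxConst α * (bigLam ε₀)⁻¹ * B :=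
          mul_le_mul_of_nonneg_left (hB _ x) (by positivity)
        exact mul_le_mul h2 hE2 (physEnergy_nonneg ε₀ W _ x) (by positivity)
      have hcx : 2 * c * Real.exp (2 * x)
          = 2 * fluxConst α * (bigLam ε₀)⁻¹ * B * (P * (Real.exp (2 * x) * q ^ 2))
            + 2 * fluxConst α * (bigLam ε₀)⁻¹ * B * (P * r ^ M * B ^ 2 * Real.exp (2 * x)) := by
        rw [hcdef]; ring
      rw [hcx]
      simp only [hD]
      linarith
    -- the released fence: g(x) = T(x) - c e^{2x} is antitone on (-∞, σ₀]
    set g : ℝ → ℝ := fun x => T x - c * Real.exp (2 * x) with hg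
    have hgderiv : ∀ x, HasDerivAt g (D x - c * (2 * Real.exp (2 * x))) x := fun x =>
      (hderiv x).sub ((hasDerivAt_exp_two_mul' x).const_mul c)
    have hgdiff : Differentiable ℝ g := fun x => (hgderiv x).differentiableAt
    have hanti : AntitoneOn g (Iic σ₀) := by
      apply antitoneOn_of_deriv_nonpos (convex_Iic σ₀) hgdiff.continuous.continuousOn
        (hgdiff.differentiableOn.mono interior_subset)
      intro x hx
      rw [interior_Iic] at hx
      rw [(hgderiv x).deriv]
      have := hDle x (le_of_lt hx)
      linarith
    -- T → 0 at -∞, hence g(s) ≤ 0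
    have hTlim : Tendsto T atBot (𝓝 0) := by
      have h := tendsto_finsetSum (Finset.range M)
        (fun j _ => tendsto_physEnergy_atBot hε ⟨B, hB⟩ (k - 1 + 1 + (j : ℤ)))
      rw [Finset.sum_const_zero] at h
      simpa only [hT] using h
    have hgs : g s ≤ 0 := by
      refine ge_of_tendsto hTlim (eventually_atBot.2 ⟨s, fun x hx => ?_⟩)
      have h1 : g s ≤ g x := hanti (show x ∈ Iic σ₀ from hx.trans hs) (show s ∈ Iic σ₀ from hs) hx
      have h2 : g x ≤ T x := by
        simp only [hg]
        linarith [mul_nonneg hc0 (Real.exp_pos (2 * x)).le]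
      exact h1.trans h2
    have hTs : T s ≤ c * Real.exp (2 * s) := by simp only [hg] at hgs; linarith
    -- E_{k+1}(s) ≤ T(s)
    have hEk1 : physEnergy ε₀ W (k + 1) s ≤ T s := by
      have h1 : physEnergy ε₀ W (k - 1 + 1 + ((1 : ℕ) : ℤ)) s
          ≤ ∑ j ∈ Finset.range M, physEnergy ε₀ W (k - 1 + 1 + j) s :=
        Finset.single_le_sum (f := fun j : ℕ => physEnergy ε₀ W (k - 1 + 1 + (j : ℤ)) s)
          (fun j _ => physEnergy_nonneg ε₀ W _ s) (Finset.mem_range.2 (by omega))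
      have e : k - 1 + 1 + ((1 : ℕ) : ℤ) = k + 1 := by push_cast; ring
      rw [e] at h1
      simpa only [hT] using h1
    -- read back in renormalised amplitude
    have hexp : 0 < Real.exp (2 * s) := Real.exp_pos _
    have h1 : Real.exp (2 * s) * ‖W (k + 1) s‖ ^ 2 ≤ Real.exp (2 * s) * ((bigLam ε₀ ^ (k + 1)) ^ 2 * c) := by
      rw [exp_mul_normSq_eq_physEnergy hε W (k + 1) s]
      have h2 : (bigLam ε₀ ^ (k + 1)) ^ 2 * physEnergy ε₀ W (k + 1) s
          ≤ (bigLam ε₀ ^ (k + 1)) ^ 2 * (c * Real.exp (2 * s)) :=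
        mul_le_mul_of_nonneg_left (hEk1.trans hTs) (by positivity)
      linarith [h2]
    have h3 : ‖W (k + 1) s‖ ^ 2 ≤ (bigLam ε₀ ^ (k + 1)) ^ 2 * c := le_of_mul_le_mul_left h1 hexp
    have h4 : (bigLam ε₀ ^ (k + 1)) ^ 2 * c
        = bigLam ε₀ ^ 4 * (bigLam ε₀)⁻¹ * fluxConst α * B * (q ^ 2 + B ^ 2 * r ^ M) := by
      rw [hcdef, ← hweight]; ring
    have h5 : bigLam ε₀ ^ 4 * (bigLam ε₀)⁻¹ = bigLam ε₀ ^ 3 := by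
      field_simp
    rw [h4, h5] at h3
    linarith [h3]
  -- send M → ∞
  refine le_of_forall_pos_lt_add fun η hη => ?_
  have ht : Tendsto (fun M : ℕ => bigLam ε₀ ^ 3 * fluxConst α * B ^ 3 * r ^ M) atTop
      (𝓝 (bigLam ε₀ ^ 3 * fluxConst α * B ^ 3 * 0)) :=
    (tendsto_pow_atTop_nhds_zero_of_lt_one hr0 hr1).const_mul _
  rw [mul_zero] at ht
  obtain ⟨M, hM⟩ := ((ht.eventually (gt_mem_nhds hη)).and (eventually_ge_atTop 2)).exists
  have := hmain M hM.2
  linarith [hM.1]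

/-! ## Quietness climbs the ladder -/

/-- **QUIETNESS CLIMBS THE LADDER.**  Let `W` be an admissible eternal solution with covariant viscosity
`ν̂ ≥ 0` of a cancelling table with `‖W‖ ≤ B`, and `q ≥ 0` a level with `2 Λ C_A q ≤ 1` and
`16 Λ C_A³ B q² ≤ 1`.  If shell `n` obeys `‖W_n‖ ≤ q` on `(-∞, σ₀]`, then EVERY shell `n + i`, `i ≥ 0`, obeys
`‖W_{n+i}‖ ≤ q` on `(-∞, σ₀]` (induction: `normSq_succ_le_of_quiet_below` puts shell `n+i+2` inside the
backscatter margin `4 C_A ‖W_{n+i+2}‖ ≤ Λ` on `(-∞, σ₀]`, and `norm_le_slaved` gives `‖W_{n+i+1}‖ ≤ 2ΛC_A q² ≤ q`).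
[cite: Tao2016AveragedNS, §4 (4.1), (4.3), Lemma 4.1 (4.8)–(4.10), §5 (energy climbs one shell at a time), §6.4] -/
theorem quiet_propagate (hε : 0 < ε₀) (hW : IsEternalVisc ε₀ νh α W) (hc : IsCancellingCoeff α)
    {B : ℝ} (hB : ∀ (j : ℤ) (σ : ℝ), ‖W j σ‖ ≤ B) {q : ℝ} (hq0 : 0 ≤ q)
    (hq2 : 2 * bigLam ε₀ * fluxConst α * q ≤ 1)
    (hqB : 16 * bigLam ε₀ * fluxConst α ^ 3 * B * q ^ 2 ≤ 1)
    {n : ℤ} {σ₀ : ℝ} (h0 : ∀ s, s ≤ σ₀ → ‖W n s‖ ≤ q) :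
    ∀ (i : ℕ) (s : ℝ), s ≤ σ₀ → ‖W (n + i) s‖ ≤ q := by
  have hΛ : 0 < bigLam ε₀ := bigLam_pos (by linarith)
  have hCA : 0 ≤ fluxConst α := fluxConst_nonneg α
  have hB0 : 0 ≤ B := (norm_nonneg _).trans (hB 0 0)
  intro i
  induction i with
  | zero => intro s hs; simpa using h0 s hs
  | succ i ih =>
    intro s hs
    have e1 : n + ((i + 1 : ℕ) : ℤ) = n + i + 1 := by push_cast; ring
    rw [e1]
    -- the shell below is quiet
    have hbelow : ∀ s', s' ≤ σ₀ → ‖W (n + i + 1 - 1) s'‖ ≤ q := by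
      intro s' hs'
      have e2 : n + (i : ℤ) + 1 - 1 = n + i := by ring
      rw [e2]; exact ih s' hs'
    -- the shell two above is inside the backscatter margin
    have hsq := normSq_succ_le_of_quiet_below hε hW hc hB (k := n + i + 1) hbelow
    have hmar : ∀ s', s' ≤ σ₀ → 4 * fluxConst α * ‖W (n + i + 1 + 1) s'‖ ≤ bigLam ε₀ := by
      intro s' hs'
      have h1 := hsq s' hs'
      have h2 : (4 * fluxConst α * ‖W (n + i + 1 + 1) s'‖) ^ 2 ≤ bigLam ε₀ ^ 2 := by
        have h3 : (4 * fluxConst α * ‖W (n + i + 1 + 1) s'‖) ^ 2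
            = 16 * fluxConst α ^ 2 * ‖W (n + i + 1 + 1) s'‖ ^ 2 := by ring
        rw [h3]
        calc 16 * fluxConst α ^ 2 * ‖W (n + ↑i + 1 + 1) s'‖ ^ 2
            ≤ 16 * fluxConst α ^ 2 * (bigLam ε₀ ^ 3 * fluxConst α * B * q ^ 2) :=
              mul_le_mul_of_nonneg_left h1 (by positivity)
          _ = bigLam ε₀ ^ 2 * (16 * bigLam ε₀ * fluxConst α ^ 3 * B * q ^ 2) := by ring
          _ ≤ bigLam ε₀ ^ 2 * 1 := mul_le_mul_of_nonneg_left hqB (by positivity)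
          _ = bigLam ε₀ ^ 2 := mul_one _
      exact (pow_le_pow_iff_left₀ (by positivity) hΛ.le two_ne_zero).1 h2
    have hslave := norm_le_slaved hε hW hc (k := n + i + 1) (σ₁ := σ₀) (M := q) (D := B)
      hbelow hmar (fun s' _ => hB _ s') s hs
    calc ‖W (n + ↑i + 1) s‖ ≤ 2 * bigLam ε₀ * fluxConst α * q ^ 2 := hslave
      _ = (2 * bigLam ε₀ * fluxConst α * q) * q := by ring
      _ ≤ 1 * q := mul_le_mul_of_nonneg_right hq2 hq0
      _ = q := one_mul q

/-! ## Every tail is quiet in some past — any `ν̂ ≥ 0`, any cancelling table -/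

/-- **EVERY TAIL OF A UNIFORMLY BOUNDED ADMISSIBLE ETERNAL SOLUTION IS QUIET IN SOME PAST** (every cancelling
table, every `ε₀ > 0`, every covariant viscosity `ν̂ ≥ 0`, every level `q > 0`): for every shell `n` there is
`σ₀` with `‖W_k(s)‖ ≤ q` for all `k ≥ n` and all `s ≤ σ₀`.  The activity of a bounded admissible eternal
solution never descends from `k = +∞`: in the far past every tail is dark.  (Inviscid: the single shell `n`
tends to `0` at `-∞` — `tendsto_norm_atBot_of_isEternal` — and `quiet_propagate` at the level
`min q (1/(2Λ(C_A+1) + 16ΛC_A³B + 1))`; `ν̂ > 0`: `exists_quietPast_of_visc`.)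
[cite: Tao2016AveragedNS, §4 (4.1), (4.3), Lemma 4.1 (4.8)–(4.10), the viscous equation before Thm. 4.2, §5, §6.4; cell admissibility clauses of `IsEternalVisc`] -/
theorem exists_quietPast (hε : 0 < ε₀) (hW : IsEternalVisc ε₀ νh α W) (hc : IsCancellingCoeff α)
    (hU : UniformBound W) (n : ℤ) {q : ℝ} (hq : 0 < q) :
    ∃ σ₀ : ℝ, ∀ k : ℤ, n ≤ k → ∀ s, s ≤ σ₀ → ‖W k s‖ ≤ q := by
  by_cases hν : 0 < νh
  · exact exists_quietPast_of_visc hε hν hW hc hU n hq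
  · have hν0 : νh = 0 := le_antisymm (not_lt.1 hν) hW.nonneg
    subst hν0
    have hE : IsEternal ε₀ α W := isEternalVisc_zero_iff.1 hW
    obtain ⟨B, hB⟩ := hU
    have hΛ : 0 < bigLam ε₀ := bigLam_pos (by linarith)
    have hCA : 0 ≤ fluxConst α := fluxConst_nonneg α
    have hB0 : 0 ≤ B := (norm_nonneg _).trans (hB 0 0)
    have h2A : 0 ≤ 2 * bigLam ε₀ * (fluxConst α + 1) := by positivity
    have h16 : 0 ≤ 16 * bigLam ε₀ * fluxConst α ^ 3 * B := by positivity
    set d : ℝ := 2 * bigLam ε₀ * (fluxConst α + 1) + 16 * bigLam ε₀ * fluxConst α ^ 3 * B + 1 with hd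
    have hd1 : 1 ≤ d := by rw [hd]; linarith
    have hd0 : 0 < d := by linarith
    set q' : ℝ := min q (1 / d) with hq'
    have hq'0 : 0 < q' := lt_min hq (by positivity)
    have hq'q : q' ≤ q := min_le_left _ _
    have hq'd' : q' * d ≤ 1 := by
      have h1 : q' * d ≤ (1 / d) * d := mul_le_mul_of_nonneg_right (min_le_right q (1 / d)) hd0.le
      rwa [one_div, inv_mul_cancel₀ hd0.ne'] at h1
    have hq'1 : q' ≤ 1 := by nlinarith
    have hc2 : 2 * bigLam ε₀ * fluxConst α * q' ≤ 1 := by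
      have h1 : 2 * bigLam ε₀ * fluxConst α ≤ d := by rw [hd]; nlinarith
      nlinarith [mul_le_mul_of_nonneg_right h1 hq'0.le]
    have hcB : 16 * bigLam ε₀ * fluxConst α ^ 3 * B * q' ^ 2 ≤ 1 := by
      have h1 : 16 * bigLam ε₀ * fluxConst α ^ 3 * B ≤ d := by rw [hd]; linarith
      calc 16 * bigLam ε₀ * fluxConst α ^ 3 * B * q' ^ 2
          ≤ 16 * bigLam ε₀ * fluxConst α ^ 3 * B * q' := by
            have : q' ^ 2 ≤ q' := by nlinarith
            exact mul_le_mul_of_nonneg_left this h16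
        _ ≤ d * q' := mul_le_mul_of_nonneg_right h1 hq'0.le
        _ = q' * d := mul_comm _ _
        _ ≤ 1 := hq'd'
    have hlim := tendsto_norm_atBot_of_isEternal hε hE hB n
    have hev : ∀ᶠ s in atBot, ‖W n s‖ < q' := (tendsto_order.1 hlim).2 q' hq'0
    obtain ⟨σ₀, hσ₀⟩ := eventually_atBot.1 hev
    refine ⟨σ₀, fun k hk s hs => ?_⟩
    have hprop := quiet_propagate hε hW hc hB hq'0.le hc2 hcB (n := n) (σ₀ := σ₀)
      (fun s' hs' => (hσ₀ s' hs').le)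
    obtain ⟨i, hi⟩ : ∃ i : ℕ, k = n + i := ⟨(k - n).toNat, by omega⟩
    subst hi
    exact (hprop i s hs).trans hq'q

/-! ## Consequences: ordered ignition, the loud down-set and «survival lights every shell», unconditionally -/

/-- **ORDERED IGNITION, unconditional (any `ν̂ ≥ 0`, any cancelling table).**  Let `W` be a uniformly bounded
admissible eternal solution and `q > 0` a level with `4 C_A q ≤ Λ`, `2 Λ C_A q² < q`.  If some shell `k ≥ n`
exceeds `q` at a log-time `s ≤ σ₁`, then the shell `n - 1` exceeded every sub-ignition level `M`
(`2 Λ C_A M² < q`) at some log-time `≤ σ₁`: a tail is lit only from the shell just below it.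
[cite: Tao2016AveragedNS, §4 (4.1), (4.3), Lemma 4.1 (4.8)–(4.10); §5; §6.4] -/
theorem orderedIgnition_all (hε : 0 < ε₀) (hW : IsEternalVisc ε₀ νh α W)
    (hc : IsCancellingCoeff α) (hU : UniformBound W) {q : ℝ} (hq0 : 0 < q)
    (hq4 : 4 * fluxConst α * q ≤ bigLam ε₀) (hq2 : 2 * bigLam ε₀ * fluxConst α * q ^ 2 < q)
    {n k : ℤ} (hk : n ≤ k) {σ₁ s : ℝ} (hs : s ≤ σ₁) (hloud : q < ‖W k s‖)
    {M : ℝ} (hMq : 2 * bigLam ε₀ * fluxConst α * M ^ 2 < q) :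
    ∃ s', s' ≤ σ₁ ∧ M < ‖W (n - 1) s'‖ := by
  obtain ⟨σ₀, hσ₀⟩ := exists_quietPast hε hW hc hU n hq0
  have h0 : ∀ k' : ℤ, n ≤ k' → ∀ s', s' ≤ min σ₀ σ₁ → ‖W k' s'‖ ≤ q :=
    fun k' hk' s' hs' => hσ₀ k' hk' s' (hs'.trans (min_le_left _ _))
  exact orderedIgnition_of_quietPast hε hW hc hU (min_le_right σ₀ σ₁) hq4 hq2 h0 hk hs hloud hMq

/-- **THE LOUD SET IS A DOWN-SET, unconditionally (any `ν̂ ≥ 0`, any cancelling table).**  At the canonical level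
`q₀ = 1/(4Λ(C_A+1))`: if shell `k` of a uniformly bounded admissible eternal solution is loud (`‖W_k(s)‖ > q₀`) at
some `s ≤ σ₁`, then EVERY shell `j ≤ k` was loud at some log-time `≤ σ₁`.
[cite: Tao2016AveragedNS, §4 (4.1), (4.3), Lemma 4.1 (4.8)–(4.10); §5; §6.4] -/
theorem loud_downset_all (hε : 0 < ε₀) (hW : IsEternalVisc ε₀ νh α W) (hc : IsCancellingCoeff α)
    (hU : UniformBound W) {k : ℤ} {σ₁ s : ℝ} (hs : s ≤ σ₁)
    (hloud : 1 / (4 * bigLam ε₀ * (fluxConst α + 1)) < ‖W k s‖) :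
    ∀ j : ℤ, j ≤ k → ∃ s', s' ≤ σ₁ ∧ 1 / (4 * bigLam ε₀ * (fluxConst α + 1)) < ‖W j s'‖ := by
  have hΛ : 0 < bigLam ε₀ := bigLam_pos (by linarith)
  have hCA : 0 ≤ fluxConst α := fluxConst_nonneg α
  have hq0 : 0 < 1 / (4 * bigLam ε₀ * (fluxConst α + 1)) := by positivity
  exact loud_downset_of_quietPast hε hW hc hU (fun n => exists_quietPast hε hW hc hU n hq0) hs hloud

/-- **(S₁)-SURVIVAL LIGHTS EVERY SHELL — unconditionally, for every `ν̂ ≥ 0` and every cancelling table.**  A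
uniformly bounded admissible eternal solution with covariant viscosity that is forward (S₁)-surviving exceeds
`q₀ = 1/(4Λ(C_A+1))` on EVERY shell `j ∈ ℤ` at some log-time.  (`survivingFwd_loud_everywhere_of_quietPast` with
the quiet past supplied by `exists_quietPast`; previously known for `ν̂ > 0`, on sign-coherent bonds and on the DSS
stratum only.)
[cite: Tao2016AveragedNS, §4 Thm. 4.2 (statement shape), (4.3), Lemma 4.1 (4.8)–(4.10); §6.4] -/
theorem survivingFwd_loud_everywhere (hε : 0 < ε₀) (hW : IsEternalVisc ε₀ νh α W)
    (hc : IsCancellingCoeff α) (hU : UniformBound W) (hS : EternalSurvivingFwd 1 ε₀ W) :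
    ∀ j : ℤ, ∃ s : ℝ, 1 / (4 * bigLam ε₀ * (fluxConst α + 1)) < ‖W j s‖ := by
  have hΛ : 0 < bigLam ε₀ := bigLam_pos (by linarith)
  have hCA : 0 ≤ fluxConst α := fluxConst_nonneg α
  have hq0 : 0 < 1 / (4 * bigLam ε₀ * (fluxConst α + 1)) := by positivity
  exact survivingFwd_loud_everywhere_of_quietPast hε hW hc hU
    (fun n => exists_quietPast hε hW hc hU n hq0) hS

/-- **BY NAME on the binders of the crux K1ᵛ(1)** (`InTableClass R α`, `IsEternalVisc ε₀ ν̂ α W`, `UniformBound W`,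
`EternalSurvivingFwd 1 ε₀ W`; every `ε₀ > 0`, every `ν̂ ≥ 0`, no threshold): a would-be counterexample to
`NoSurvivingEternalViscBdd R 1` is LOUD ON EVERY SHELL — each `W_j`, `j ∈ ℤ`, exceeds `1/(4Λ(C_A+1))` at some
log-time — and every one of its tails was dark in some past.  The two split children (ρ0) (`ν̂ = 0`) and (ρ+)
(`ν̂ > 0`) are covered alike.
[cite: Tao2016AveragedNS, §4 Thm. 4.2 (statement shape), (4.2)–(4.3), Lemma 4.1 (4.8)–(4.10); §6.4] -/
theorem loud_everywhere_of_crux_binders {R ε₀ νh : ℝ} (hε : 0 < ε₀)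
    {α : Fin 4 → Fin 4 → Fin 4 → ℤ × ℤ × ℤ → ℝ} (hα : InTableClass R α) {W : ℤ → ℝ → Em 4}
    (hW : IsEternalVisc ε₀ νh α W) (hU : UniformBound W) (hS : EternalSurvivingFwd 1 ε₀ W) :
    (∀ j : ℤ, ∃ s : ℝ, 1 / (4 * bigLam ε₀ * (fluxConst α + 1)) < ‖W j s‖) ∧
      ∀ (n : ℤ) (q : ℝ), 0 < q → ∃ σ₀ : ℝ, ∀ k : ℤ, n ≤ k → ∀ s, s ≤ σ₀ → ‖W k s‖ ≤ q :=
  ⟨survivingFwd_loud_everywhere hε hW hα.2.1 hU hS, fun n _ hq => exists_quietPast hε hW hα.2.1 hU n hq⟩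

end Summit.NavierStokesRegularity.NavierStokesRegularity.Theorems.NoSurvivingEternalViscBddOne.TailBarrier

end
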